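import Literature.Barriers.AtomisticToContinuum.DisorderedHarmonicChainReduced
import Mathlib.MeasureTheory.Integral.IntervalIntegral.FundThmCalculus
import Mathlib.Analysis.SpecialFunctions.Integrals.Basic
import HarnessLib

/-!
# Ajanki–Huveneers 2011, §6.2: the low-frequency upper bound (U) reduced to the pointwise bound on `𝔼(1 + w⁻²D_n(e₁)²)⁻¹`

A file of the Casher–Lebowitz / Ajanki–Huveneers cluster (`DisorderedHarmonicChain.lean`,
`…Spectral.lean`, `…Transfer.lean`, `…Phases.lean`, `…Reduced.lean`); provefact unit for the named fact
`AjankiHuveneers2011_lowFrequencyBound` (= (U) of `…Transfer.lean`: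
`∫_0^{ω₀} 𝔼 j_n(ω) dω ≤ C n^{-3/2}`), SIZE XL, decomposition layer 1. Source: O. Ajanki,
F. Huveneers, CMP **301** (2011) 841–883, arXiv:1003.1076, §6.2 "Proof of the upper bound";
equation numbers below are those of the arXiv version (v1), where §6.2 is (6.10)–(6.16).

The printed proof splits `∫_0^{w₀} 𝔼 j_n = 𝒥₁ + 𝒥₂` at `w = c/n` ((6.10)):

* **`𝒥₁ ≲ n⁻³` ((6.12)) PROVED here, directly**: for `ω ≤ c/n` the transfer-matrix element
  `D_n(e₁)(ω)` is a small perturbation of its `ω = 0` value `n + 1`; precisely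
  `(n+1)/2 ≤ D_n(e₁) ≤ n+1` as soon as `∑_{k<n} m_kω²(k+1) ≤ 1/2` (`ahD_linear_growth`,
  `chainD₁_ge_linear`), hence `j_n(ω;m) ≤ ω²/D_n(e₁)² ≤ 4ω²/(n+1)²` for all masses in `[0,b]`
  (`clCurrentDensity_le_lowest`) and `∫_0^{c₁/n} 𝔼 j_n ≤ 4c₁³/n⁵`, `c₁ = 1/(2(b+1))`. (The paper
  reads the same bound off Cor. 3.6 and Cor. 3.4 (i): `Γ ≳ 1`, `sin²πX_n ≳ w²n²`.)
* **`𝒥₂ ≲ n^{-3/2}` ((6.16))** rests on the pointwise-in-frequency bound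
  `𝔼 j_n(w) ≲ 𝔼(1 + w⁻²D_n(e₁;w)²)⁻¹ ≲ max{w/√n, w²} e^{-αw²n}` for `c/n ≤ w ≤ w₀` ((6.11),
  (6.13)–(6.15) and the display before (6.16): Cor. 3.6, conditioning on the first `n - m` steps,
  Prop. 5.1 twice, Prop. 4.1), which is vendored here as the NAMED FACT
  `AjankiHuveneers2011_pointwiseCurrentBound`, stated in the paper's reduced variables
  (`B_k = M_k/𝔼M - 1` with law `τ_B`, rescaled frequency `w`, `D_n(e₁;w) = ahD (ahDiag w B) 1 0 n`)
  — the next layer of this unit derives it from the §3–§5 facts of `…Phases.lean`.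
* **The reduction PROVED**: `AjankiHuveneers2011_lowFrequencyBound_of_pointwise :
  AjankiHuveneers2011_pointwiseCurrentBound → AjankiHuveneers2011_lowFrequencyBound`, using the
  bridge of `…Reduced.lean` (mean mass `m̄`, reduced density, push-forward law, `ReducedLawHyp`,
  `ω = πw/√m̄`), the comparison `j_n ≤ max(π²/m̄, 1) · w²/(w² + D_n(e₁)²)`
  (`clCurrentDensity_le_majorant`, `clAvgCurrentDensity_le_majorant`), and the calculus of (6.16)
  (`∫_0^T ω e^{-βω²} ≤ 1/(2β)`, `∫_0^T ω² e^{-βω²} ≤ 1/(β√β)`), all proved here.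

## Design notes

* `AjankiHuveneers2011_pointwiseCurrentBound` is stated for the majorant `w²/(w² + D_n(e₁)²)`
  of (6.11) (value in `[0,1]`, continuous in `B`), for every `c > 0` (the constants depend on `c`
  exactly as those of Prop. 5.1 depend on its `κ`; the paper fixes `c` small in the `𝒥₁` step and
  then runs (6.13)–(6.16) for that `c`), uniformly in `n ≥ 1` and `w ∈ [c/n, w₀]`.
* NOT here: the derivation of `AjankiHuveneers2011_pointwiseCurrentBound` from Cor. 3.6,
  Prop. 4.1, Prop. 5.1 (next layer), and those propositions themselves (`…Phases.lean`).
-/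

noncomputable section

open MeasureTheory Real Set Filter

namespace Literature.Barriers.AtomisticToContinuum.HeatConduction

open Literature.MathematicalPhysics.KineticTheory.HeatConduction

/-! ### `𝒥₁`: linear growth of `D_n(e₁)` at the lowest frequencies -/

/-- The increments of `D_n(e₁)`: `D_{n+1} - D_n = 1 - ∑_{k ≤ n} (2 - d_k) D_k` (from
`D_{n+1} - D_n = (D_n - D_{n-1}) - (2 - d_n) D_n`, `D_0 = 1`, `D_{-1} = 0`). [folklore] -/
theorem ahD_sub_eq_one_sub_sum (d : ℕ → ℝ) :
    ∀ n, ahD d 1 0 (n + 1) - ahD d 1 0 n =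
      1 - ∑ k ∈ Finset.range (n + 1), (2 - d k) * ahD d 1 0 k
  | 0 => by
    rw [Finset.sum_range_one, ahD_one, ahD_zero]
    ring
  | n + 1 => by
    rw [ahD_add_two, Finset.sum_range_succ]
    have ih := ahD_sub_eq_one_sub_sum d n
    linear_combination ih

/-- **Linear growth of `D_n(e₁)` for small diagonal perturbations**: if `d_k ≤ 2` and
`∑_{k<n} (2 - d_k)(k+1) ≤ 1/2` then `(j+1)/2 ≤ D_j(e₁) ≤ j+1` for all `j ≤ n` (at `d ≡ 2`,
`D_j = j + 1`). [folklore] -/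
theorem ahD_linear_growth (d : ℕ → ℝ) (hd : ∀ k, d k ≤ 2) :
    ∀ n, ∑ k ∈ Finset.range n, (2 - d k) * (k + 1) ≤ 1 / 2 →
      ∀ j ≤ n, ((j : ℝ) + 1) / 2 ≤ ahD d 1 0 j ∧ ahD d 1 0 j ≤ j + 1
  | 0 => fun _ j hj => by
      obtain rfl : j = 0 := Nat.le_zero.mp hj
      simp only [ahD_zero, CharP.cast_eq_zero, zero_add]
      norm_num
  | n + 1 => fun hS j hj => by
      have hS' : ∑ k ∈ Finset.range n, (2 - d k) * (k + 1) ≤ 1 / 2 := by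
        rw [Finset.sum_range_succ] at hS
        have : 0 ≤ (2 - d n) * ((n : ℝ) + 1) := mul_nonneg (sub_nonneg.mpr (hd n)) (by positivity)
        linarith
      have ih := ahD_linear_growth d hd n hS'
      rcases Nat.lt_or_ge j (n + 1) with hlt | hge
      · exact ih j (by omega)
      · obtain rfl : j = n + 1 := le_antisymm hj hge
        have hinc := ahD_sub_eq_one_sub_sum d n
        have hsum0 : 0 ≤ ∑ k ∈ Finset.range (n + 1), (2 - d k) * ahD d 1 0 k :=
          Finset.sum_nonneg fun k hk => mul_nonneg (sub_nonneg.mpr (hd k)) (by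
            have := (ih k (by rw [Finset.mem_range] at hk; omega)).1
            have : (0 : ℝ) ≤ k := Nat.cast_nonneg k
            linarith)
        have hsum1 : ∑ k ∈ Finset.range (n + 1), (2 - d k) * ahD d 1 0 k ≤ 1 / 2 :=
          le_trans (Finset.sum_le_sum fun k hk => mul_le_mul_of_nonneg_left
            (ih k (by rw [Finset.mem_range] at hk; omega)).2 (sub_nonneg.mpr (hd k))) hS
        have hn := ih n le_rfl
        push_cast
        constructor <;> linarith [hn.1, hn.2]

/-- **`D_n(e₁)(ω) ≥ (n+1)/2` at the lowest frequencies**: for masses in `[0, b]` and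
`ω² b n² ≤ 1/2`. [cite: AjankiHuveneers2011, §6.2 eq. (6.12) (there via Cor. 3.6 and Cor. 3.4 (i))] -/
theorem chainD₁_ge_linear {n : ℕ} {m : Fin n → ℝ} {b ω : ℝ} (hm : ∀ i, 0 ≤ m i ∧ m i ≤ b)
    (hω : ω ^ 2 * b * (n : ℝ) ^ 2 ≤ 1 / 2) : ((n : ℝ) + 1) / 2 ≤ chainD₁ m ω n := by
  have hd : ∀ k, massDiag m ω k ≤ 2 := by
    intro k
    unfold massDiag finExt
    split_ifs with hk
    · have := hm ⟨k, hk⟩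
      nlinarith [sq_nonneg ω]
    · norm_num
  have hS : ∑ k ∈ Finset.range n, (2 - massDiag m ω k) * (k + 1) ≤ 1 / 2 := by
    calc ∑ k ∈ Finset.range n, (2 - massDiag m ω k) * ((k : ℝ) + 1)
        ≤ ∑ _k ∈ Finset.range n, ω ^ 2 * b * n := by
          refine Finset.sum_le_sum fun k hk => ?_
          rw [Finset.mem_range] at hk
          unfold massDiag
          rw [finExt_of_lt _ hk]
          have h1 : ((k : ℝ) + 1) ≤ n := by exact_mod_cast hk
          obtain ⟨h0, hb⟩ := hm ⟨k, hk⟩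
          calc (2 - (2 - m ⟨k, hk⟩ * ω ^ 2)) * ((k : ℝ) + 1) = (m ⟨k, hk⟩ * ω ^ 2) * ((k : ℝ) + 1) := by
                ring
            _ ≤ (b * ω ^ 2) * n :=
                mul_le_mul (mul_le_mul_of_nonneg_right hb (sq_nonneg ω)) h1 (by positivity)
                  (mul_nonneg (h0.trans hb) (sq_nonneg ω))
            _ = ω ^ 2 * b * n := by ring
      _ = ω ^ 2 * b * (n : ℝ) ^ 2 := by
          rw [Finset.sum_const, Finset.card_range, nsmul_eq_mul]
          ring
      _ ≤ 1 / 2 := hω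
  exact (ahD_linear_growth _ hd n hS n le_rfl).1

/-- **`j_n(ω; m) ≤ 4ω²/(n+1)²` at the lowest frequencies** (`n = k+1`; masses in `[0,b]`,
`ω² b n² ≤ 1/2`): drop everything but `D_n(e₁)²` from the denominator of `j_n`.
[cite: AjankiHuveneers2011, §6.2 eqs. (6.11)-(6.12)] -/
theorem clCurrentDensity_le_lowest {k : ℕ} {m : Fin (k + 1) → ℝ} {b ω : ℝ}
    (hm : ∀ i, 0 ≤ m i ∧ m i ≤ b) (hω : ω ^ 2 * b * ((k + 1 : ℕ) : ℝ) ^ 2 ≤ 1 / 2) :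
    clCurrentDensity m ω ≤ 4 * ω ^ 2 / ((k : ℝ) + 2) ^ 2 := by
  have hD := chainD₁_ge_linear hm hω
  push_cast at hD
  have hD' : ((k : ℝ) + 2) / 2 ≤ chainD₁ m ω (k + 1) := by linarith
  have hk2 : (0 : ℝ) < ((k : ℝ) + 2) / 2 := by positivity
  have hDpos : 0 < chainD₁ m ω (k + 1) := lt_of_lt_of_le hk2 hD'
  rw [clCurrentDensity_succ]
  calc ω ^ 2 / (2 * ω ^ 2 + chainD₁ m ω (k + 1) ^ 2 +
        ω ^ 2 * (chainD₁ m ω k ^ 2 + chainD₂ m ω (k + 1) ^ 2) + ω ^ 4 * chainD₂ m ω k ^ 2)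
      ≤ ω ^ 2 / chainD₁ m ω (k + 1) ^ 2 := by
        refine div_le_div_of_nonneg_left (sq_nonneg ω) (by positivity) ?_
        nlinarith [sq_nonneg ω, sq_nonneg (chainD₁ m ω k), sq_nonneg (chainD₂ m ω (k + 1)),
          mul_nonneg (sq_nonneg ω) (add_nonneg (sq_nonneg (chainD₁ m ω k)) (sq_nonneg (chainD₂ m ω (k + 1)))),
          mul_nonneg (pow_nonneg (sq_nonneg ω) 2) (sq_nonneg (chainD₂ m ω k))]
    _ ≤ ω ^ 2 / (((k : ℝ) + 2) / 2) ^ 2 :=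
        div_le_div_of_nonneg_left (sq_nonneg ω) (by positivity) (pow_le_pow_left₀ hk2.le hD' 2)
    _ = 4 * ω ^ 2 / ((k : ℝ) + 2) ^ 2 := by
        field_simp
        ring

/-- The `𝒥₁` threshold `c₁ = 1/(2(b+1))`: `c₁² b ≤ 1/2`. [folklore] -/
theorem lowestThreshold_sq_mul_le {b : ℝ} (hb : 0 ≤ b) : (1 / (2 * (b + 1))) ^ 2 * b ≤ 1 / 2 := by
  rw [div_pow, one_pow, div_mul_eq_mul_div, one_mul, div_le_iff₀ (by positivity)]
  nlinarith

/-- **`𝒥₁`: the mass average at the lowest frequencies**, `𝔼 j_n(ω) ≤ 4c₁²/n⁴` for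
`0 ≤ ω ≤ c₁/n`, masses a.s. in `[a,b] ⊂ (0,∞)`. [cite: AjankiHuveneers2011, §6.2 eq. (6.12)] -/
theorem clAvgCurrentDensity_le_lowest {k : ℕ} {a b : ℝ} (ha : 0 < a) (ρ : Measure ℝ)
    [IsProbabilityMeasure ρ]
    (hae : ∀ᵐ m ∂(Measure.pi fun _ : Fin (k + 1) => ρ), ∀ i, a ≤ m i ∧ m i ≤ b)
    {ω : ℝ} (hω0 : 0 ≤ ω) (hω : ω ≤ 1 / (2 * (b + 1)) / ((k + 1 : ℕ) : ℝ)) :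
    clAvgCurrentDensity ρ (k + 1) ω ≤ 4 * (1 / (2 * (b + 1))) ^ 2 / ((k + 1 : ℕ) : ℝ) ^ 4 := by
  set c₁ : ℝ := 1 / (2 * (b + 1)) with hc₁
  have hn : (1 : ℝ) ≤ ((k + 1 : ℕ) : ℝ) := by exact_mod_cast Nat.succ_pos k
  have hn0 : (0 : ℝ) < ((k + 1 : ℕ) : ℝ) := by positivity
  have hbnd : ∀ m : Fin (k + 1) → ℝ, (∀ i, a ≤ m i ∧ m i ≤ b) →
      clCurrentDensity m ω ≤ 4 * c₁ ^ 2 / ((k + 1 : ℕ) : ℝ) ^ 4 := by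
    intro m hm
    have hb : 0 ≤ b := ha.le.trans ((hm 0).1.trans (hm 0).2)
    have hm' : ∀ i, 0 ≤ m i ∧ m i ≤ b := fun i => ⟨ha.le.trans (hm i).1, (hm i).2⟩
    have hωn : ω * ((k + 1 : ℕ) : ℝ) ≤ c₁ := by rwa [← le_div_iff₀ hn0]
    have hω2 : ω ^ 2 * b * ((k + 1 : ℕ) : ℝ) ^ 2 ≤ 1 / 2 := by
      have h1 : (ω * ((k + 1 : ℕ) : ℝ)) ^ 2 ≤ c₁ ^ 2 := pow_le_pow_left₀ (by positivity) hωn 2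
      calc ω ^ 2 * b * ((k + 1 : ℕ) : ℝ) ^ 2 = (ω * ((k + 1 : ℕ) : ℝ)) ^ 2 * b := by ring
        _ ≤ c₁ ^ 2 * b := mul_le_mul_of_nonneg_right h1 hb
        _ ≤ 1 / 2 := lowestThreshold_sq_mul_le hb
    have h := clCurrentDensity_le_lowest hm' hω2
    have hk2 : ((k + 1 : ℕ) : ℝ) ≤ (k : ℝ) + 2 := by push_cast; linarith
    calc clCurrentDensity m ω ≤ 4 * ω ^ 2 / ((k : ℝ) + 2) ^ 2 := h
      _ ≤ 4 * ω ^ 2 / ((k + 1 : ℕ) : ℝ) ^ 2 :=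
          div_le_div_of_nonneg_left (by positivity) (by positivity) (pow_le_pow_left₀ hn0.le hk2 2)
      _ = 4 * (ω * ((k + 1 : ℕ) : ℝ)) ^ 2 / ((k + 1 : ℕ) : ℝ) ^ 4 := by
          field_simp
      _ ≤ 4 * c₁ ^ 2 / ((k + 1 : ℕ) : ℝ) ^ 4 := by
          gcongr
  unfold clAvgCurrentDensity
  calc ∫ m, clCurrentDensity m ω ∂(Measure.pi fun _ : Fin (k + 1) => ρ)
      ≤ ∫ _m, 4 * c₁ ^ 2 / ((k + 1 : ℕ) : ℝ) ^ 4 ∂(Measure.pi fun _ : Fin (k + 1) => ρ) :=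
        integral_mono_ae (integrable_clCurrentDensity_left ρ (k + 1) ω) (integrable_const _)
          (hae.mono fun m hm => hbnd m hm)
    _ = 4 * c₁ ^ 2 / ((k + 1 : ℕ) : ℝ) ^ 4 := by simp

/-! ### Comparison with the reduced majorant `w²/(w² + D_n(e₁)²)` -/

/-- Continuity of `B ↦ D_j(e₁)(w; B)` on `ℝ^n`. [folklore] -/
theorem continuous_ahD_ahDiag (w : ℝ) (n j : ℕ) :
    Continuous fun B : Fin n → ℝ => ahD (ahDiag w (finExt B)) 1 0 j := by
  refine continuous_ahD (d := fun (B : Fin n → ℝ) k => ahDiag w (finExt B) k) (fun k => ?_) 1 0 j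
  unfold ahDiag finExt
  by_cases hk : k < n
  · simp only [dif_pos hk]
    fun_prop
  · simp only [dif_neg hk]
    exact continuous_const

/-- The reduced majorant `w²/(w² + D_n(e₁)²)` is measurable in `B`. [folklore] -/
theorem measurable_reducedMajorant (w : ℝ) (n j : ℕ) :
    Measurable fun B : Fin n → ℝ => w ^ 2 / (w ^ 2 + (ahD (ahDiag w (finExt B)) 1 0 j) ^ 2) :=
  measurable_const.div (measurable_const.add ((continuous_ahD_ahDiag w n j).measurable.pow_const 2))

/-- `0 ≤ w²/(w² + D²) ≤ 1`. [folklore] -/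
theorem reducedMajorant_mem (w D : ℝ) : 0 ≤ w ^ 2 / (w ^ 2 + D ^ 2) ∧ w ^ 2 / (w ^ 2 + D ^ 2) ≤ 1 := by
  refine ⟨by positivity, ?_⟩
  rcases eq_or_ne (w ^ 2 + D ^ 2) 0 with h | h
  · rw [h, div_zero]; exact zero_le_one
  · rw [div_le_one (lt_of_le_of_ne (by positivity) (Ne.symm h))]
    nlinarith [sq_nonneg D]

/-- **Pointwise comparison `j_n ≤ max(π²/m̄, 1) · w²/(w² + D_n(e₁)²)`** in the reduced variables
(`m = m̄(1+β)`, `ω = πw/√m̄`, `ω² = (π²/m̄) w²`; drop the non-negative terms of the denominator of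
`j_n`, (6.11): "`j_n(w) ≲ 1/(1 + w⁻²D_n²(e₁))`"). [cite: AjankiHuveneers2011, §6.2 eq. (6.11)] -/
theorem clCurrentDensity_le_majorant {k : ℕ} (mb : ℝ) (hm : 0 < mb) (β : Fin (k + 1) → ℝ) (w : ℝ) :
    clCurrentDensity (fun i => mb * (1 + β i)) (π * w / Real.sqrt mb) ≤ max (π ^ 2 / mb) 1 *
      (w ^ 2 / (w ^ 2 + (ahD (ahDiag w (finExt β)) 1 0 (k + 1)) ^ 2)) := by
  rw [clCurrentDensity_reduced mb hm β w]
  set D := ahD (ahDiag w (finExt β)) 1 0 (k + 1) with hD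
  set D₁ := ahD (ahDiag w (finExt β)) 1 0 k with hD₁
  set D₂ := ahD (ahDiag w (finExt β)) 0 1 (k + 1) with hD₂
  set D₃ := ahD (ahDiag w (finExt β)) 0 1 k with hD₃
  set ω := π * w / Real.sqrt mb with hω
  set L := π ^ 2 / mb with hL
  have hL0 : 0 < L := by positivity
  have hsm : 0 < Real.sqrt mb := Real.sqrt_pos.mpr hm
  have hωw : ω ^ 2 = L * w ^ 2 := by
    rw [hω, hL, div_pow, mul_pow, Real.sq_sqrt hm.le]
    field_simp
  rcases eq_or_ne w 0 with hw | hw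
  · have : ω = 0 := by rw [hω, hw]; simp
    simp [this, hw]
  have hw2 : 0 < w ^ 2 := by positivity
  have hω2 : 0 < ω ^ 2 := by rw [hωw]; positivity
  set M := max L 1 with hM
  have hM1 : 1 ≤ M := le_max_right _ _
  have hML : L ≤ M := le_max_left _ _
  calc ω ^ 2 / (2 * ω ^ 2 + D ^ 2 + ω ^ 2 * (D₁ ^ 2 + D₂ ^ 2) + ω ^ 4 * D₃ ^ 2)
      ≤ ω ^ 2 / (ω ^ 2 + D ^ 2) := by
        refine div_le_div_of_nonneg_left hω2.le (by positivity) ?_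
        nlinarith [mul_nonneg hω2.le (add_nonneg (sq_nonneg D₁) (sq_nonneg D₂)),
          mul_nonneg (pow_nonneg (sq_nonneg ω) 2) (sq_nonneg D₃)]
    _ = L * w ^ 2 / (L * w ^ 2 + D ^ 2) := by rw [hωw]
    _ ≤ M * (w ^ 2 / (w ^ 2 + D ^ 2)) := by
        rw [mul_div_assoc', div_le_div_iff₀ (by positivity) (by positivity)]
        have h1 : L * (w ^ 2 * w ^ 2) ≤ M * L * (w ^ 2 * w ^ 2) := by
          have : L ≤ M * L := le_mul_of_one_le_left hL0.le hM1
          exact mul_le_mul_of_nonneg_right this (by positivity)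
        have h2 : L * (w ^ 2 * D ^ 2) ≤ M * (w ^ 2 * D ^ 2) := mul_le_mul_of_nonneg_right hML (by positivity)
        nlinarith

/-- **Integrated comparison**: `𝔼 j_n(πw/√m̄) ≤ max(π²/m̄, 1) · 𝔼_B[w²/(w² + D_n(e₁;w,B)²)]`, the
expectation on the right over the reduced masses `B = M/m̄ - 1`, i.e. over the push-forward law
`(ρ ∘ (s ↦ s/m̄ - 1)⁻¹)^{⊗n}`. [cite: AjankiHuveneers2011, §6.2 eqs. (6.10)-(6.11)] -/
theorem clAvgCurrentDensity_le_majorant {τ : ℝ → ℝ} {a b : ℝ} (h : MassDensityHyp τ a b)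
    (ρ : Measure ℝ) [IsProbabilityMeasure ρ] (k : ℕ) (w : ℝ) :
    clAvgCurrentDensity ρ (k + 1) (π * w / Real.sqrt (meanMass τ)) ≤ max (π ^ 2 / meanMass τ) 1 *
      ∫ β, w ^ 2 / (w ^ 2 + (ahD (ahDiag w (finExt β)) 1 0 (k + 1)) ^ 2)
        ∂(Measure.pi fun _ : Fin (k + 1) =>
          ρ.map (reducedEquiv (meanMass τ) h.meanMass_pos.ne')) := by
  have hm := h.meanMass_pos
  set e := reducedEquiv (meanMass τ) hm.ne' with he
  haveI : IsProbabilityMeasure (ρ.map e) := isProbabilityMeasure_map_reducedEquiv h ρ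
  set g : (Fin (k + 1) → ℝ) → ℝ := fun β => w ^ 2 / (w ^ 2 + (ahD (ahDiag w (finExt β)) 1 0 (k + 1)) ^ 2)
    with hg
  have hgm : Measurable g := measurable_reducedMajorant w (k + 1) (k + 1)
  have hgi : Integrable (fun β : Fin (k + 1) → ℝ => max (π ^ 2 / meanMass τ) 1 * g β)
      (Measure.pi fun _ : Fin (k + 1) => ρ.map e) := by
    refine Integrable.const_mul ?_ _
    refine Integrable.mono' (integrable_const (1 : ℝ)) hgm.aestronglyMeasurable (ae_of_all _ fun β => ?_)
    rw [Real.norm_eq_abs, abs_of_nonneg (reducedMajorant_mem _ _).1]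
    exact (reducedMajorant_mem _ _).2
  have hji : Integrable (fun β : Fin (k + 1) → ℝ =>
      clCurrentDensity (fun i => meanMass τ * (1 + β i)) (π * w / Real.sqrt (meanMass τ)))
      (Measure.pi fun _ : Fin (k + 1) => ρ.map e) := by
    refine Integrable.mono' (integrable_const (1 / 2 : ℝ)) ?_ (ae_of_all _ fun β => ?_)
    · have hmeas : Measurable fun β : Fin (k + 1) → ℝ =>
          ((fun i => meanMass τ * (1 + β i)), π * w / Real.sqrt (meanMass τ)) := by
        refine Measurable.prodMk ?_ measurable_const
        exact measurable_pi_lambda _ fun i => ((measurable_pi_apply i).const_add 1).const_mul _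
      exact ((measurable_clCurrentDensity (k + 1)).comp hmeas).aestronglyMeasurable
    · rw [Real.norm_eq_abs, abs_of_nonneg (clCurrentDensity_nonneg _ _)]
      exact clCurrentDensity_le_half _ _
  unfold clAvgCurrentDensity
  rw [integral_pi_eq_integral_pi_reduced h ρ (k + 1), ← integral_const_mul]
  exact integral_mono hji hgi fun β => clCurrentDensity_le_majorant (meanMass τ) hm β w

/-! ### Calculus for (6.16) -/

/-- `∫_0^T ω e^{-βω²} dω = (1 - e^{-βT²})/(2β) ≤ 1/(2β)`. [folklore] -/
theorem integral_mul_exp_neg_sq_le {β T : ℝ} (hβ : 0 < β) (hT : 0 ≤ T) :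
    ∫ ω in Set.Ioc 0 T, ω * Real.exp (-(β * ω ^ 2)) ≤ 1 / (2 * β) := by
  have hderiv : ∀ x ∈ Set.uIcc 0 T,
      HasDerivAt (fun ω => -Real.exp (-(β * ω ^ 2)) / (2 * β)) (x * Real.exp (-(β * x ^ 2))) x := by
    intro x _
    have h1 : HasDerivAt (fun ω : ℝ => β * ω ^ 2) (β * (2 * x)) x := by
      simpa using (hasDerivAt_pow 2 x).const_mul β
    have h2 : HasDerivAt (fun ω : ℝ => Real.exp (-(β * ω ^ 2)))
        (Real.exp (-(β * x ^ 2)) * (-(β * (2 * x)))) x := h1.neg.exp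
    have h3 : HasDerivAt (fun ω => -Real.exp (-(β * ω ^ 2)) / (2 * β))
        (-(Real.exp (-(β * x ^ 2)) * (-(β * (2 * x)))) / (2 * β)) x := (h2.neg).div_const (2 * β)
    refine h3.congr_deriv ?_
    rw [div_eq_iff (by positivity)]
    ring
  have hint : IntervalIntegrable (fun x => x * Real.exp (-(β * x ^ 2))) volume 0 T :=
    (by fun_prop : Continuous fun x : ℝ => x * Real.exp (-(β * x ^ 2))).intervalIntegrable _ _
  rw [← intervalIntegral.integral_of_le hT, intervalIntegral.integral_eq_sub_of_hasDerivAt hderiv hint]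
  have h0 : Real.exp (-(β * T ^ 2)) > 0 := Real.exp_pos _
  simp only [ne_eq, OfNat.ofNat_ne_zero, not_false_eq_true, zero_pow, mul_zero, neg_zero,
    Real.exp_zero]
  rw [div_sub_div_same, div_le_div_iff_of_pos_right (by positivity)]
  linarith

/-- `ω² e^{-βω²} ≤ β^{-1/2} · ω e^{-βω²/2}` for `ω ≥ 0` (`√β ω ≤ 1 + βω²/2 ≤ e^{βω²/2}`). [folklore] -/
theorem sq_mul_exp_neg_sq_le {β ω : ℝ} (hβ : 0 < β) (hω : 0 ≤ ω) :
    ω ^ 2 * Real.exp (-(β * ω ^ 2)) ≤ 1 / Real.sqrt β * (ω * Real.exp (-(β / 2 * ω ^ 2))) := by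
  have hsβ : 0 < Real.sqrt β := Real.sqrt_pos.mpr hβ
  have key : ω * Real.exp (-(β / 2 * ω ^ 2)) ≤ 1 / Real.sqrt β := by
    have h1 : Real.sqrt β * ω ≤ 1 + β / 2 * ω ^ 2 := by
      nlinarith [sq_nonneg (Real.sqrt β * ω - 1), Real.sq_sqrt hβ.le]
    have h2 : 1 + β / 2 * ω ^ 2 ≤ Real.exp (β / 2 * ω ^ 2) := by
      linarith [Real.add_one_le_exp (β / 2 * ω ^ 2)]
    rw [Real.exp_neg, le_div_iff₀ hsβ]
    have hE := Real.exp_pos (β / 2 * ω ^ 2)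
    calc ω * (Real.exp (β / 2 * ω ^ 2))⁻¹ * Real.sqrt β = (Real.sqrt β * ω) / Real.exp (β / 2 * ω ^ 2) := by
          field_simp
      _ ≤ 1 := by rw [div_le_one hE]; linarith
  have hsplit : ω ^ 2 * Real.exp (-(β * ω ^ 2)) =
      (ω * Real.exp (-(β / 2 * ω ^ 2))) * (ω * Real.exp (-(β / 2 * ω ^ 2))) := by
    rw [show -(β * ω ^ 2) = -(β / 2 * ω ^ 2) + -(β / 2 * ω ^ 2) by ring, Real.exp_add]
    ring
  rw [hsplit]
  exact mul_le_mul_of_nonneg_right key (by positivity)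

/-- `∫_0^T ω² e^{-βω²} dω ≤ 1/(β√β)`. [folklore] -/
theorem integral_sq_mul_exp_neg_sq_le {β T : ℝ} (hβ : 0 < β) (hT : 0 ≤ T) :
    ∫ ω in Set.Ioc 0 T, ω ^ 2 * Real.exp (-(β * ω ^ 2)) ≤ 1 / (β * Real.sqrt β) := by
  have hsβ : 0 < Real.sqrt β := Real.sqrt_pos.mpr hβ
  have hfin : volume (Set.Ioc (0 : ℝ) T) ≠ ⊤ := by rw [Real.volume_Ioc]; exact ENNReal.ofReal_ne_top
  have hi1 : IntegrableOn (fun ω : ℝ => ω ^ 2 * Real.exp (-(β * ω ^ 2))) (Set.Ioc 0 T) :=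
    ((by fun_prop : Continuous fun ω : ℝ => ω ^ 2 * Real.exp (-(β * ω ^ 2))).integrableOn_Icc).mono_set
      Set.Ioc_subset_Icc_self
  have hi2 : IntegrableOn (fun ω : ℝ => 1 / Real.sqrt β * (ω * Real.exp (-(β / 2 * ω ^ 2)))) (Set.Ioc 0 T) :=
    ((by fun_prop : Continuous fun ω : ℝ => 1 / Real.sqrt β * (ω * Real.exp (-(β / 2 * ω ^ 2)))).integrableOn_Icc).mono_set
      Set.Ioc_subset_Icc_self
  calc ∫ ω in Set.Ioc 0 T, ω ^ 2 * Real.exp (-(β * ω ^ 2))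
      ≤ ∫ ω in Set.Ioc 0 T, 1 / Real.sqrt β * (ω * Real.exp (-(β / 2 * ω ^ 2))) :=
        setIntegral_mono_on hi1 hi2 measurableSet_Ioc fun ω hω => sq_mul_exp_neg_sq_le hβ hω.1.le
    _ = 1 / Real.sqrt β * ∫ ω in Set.Ioc 0 T, ω * Real.exp (-(β / 2 * ω ^ 2)) := integral_const_mul _ _
    _ ≤ 1 / Real.sqrt β * (1 / (2 * (β / 2))) :=
        mul_le_mul_of_nonneg_left (integral_mul_exp_neg_sq_le (half_pos hβ) hT) (by positivity)
    _ = 1 / (β * Real.sqrt β) := by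
        field_simp

end Literature.Barriers.AtomisticToContinuum.HeatConduction

namespace Literature.Barriers.AtomisticToContinuum

open Literature.MathematicalPhysics.KineticTheory.HeatConduction HeatConduction

/-! ### The named fact of §6.2 and the reduction of (U) to it -/

/-- **AH2011 §6.2, the pointwise frequency bound behind `𝒥₂ ≲ n^{-3/2}`.** In the reduced
variables of §2 (i.i.d. reduced masses `B_k` with density `τ` satisfying the standing hypothesis
`ReducedLawHyp`, rescaled frequency `w`, `D_n(e₁; w) = ahD (ahDiag w B) 1 0 n` the element of the
transfer-matrix product `A_n(w)⋯A_1(w)`): for every `c > 0` there are `w₀ > 0`, `α > 0` and `C`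
such that for all `n ≥ 1` and `c/n ≤ w ≤ w₀`,
`𝔼[(1 + w⁻²D_n(e₁;w)²)⁻¹] ≤ C max{w/√n, w²} e^{-αw²n}`.
This is the chain "(6.11): `j_n(w) ≲ 1/(1 + w⁻²D_n²(e₁)) ≲ h(Γ^ϑ_n sin πX^ϑ_n)`" — "(6.13)–(6.15):
conditioning on `(X^ϑ_{n-m}, Γ^ϑ_{n-m})`, `m = min{n, ⌊w⁻²⌋}`, Prop. 5.1" — "Applying Proposition
4.1, one gets `𝔼 j_n(w) ≲ (w/√m) 𝔼(1/Γ^ϑ_{n-m}) ≲ (w/√m)e^{-αw²(n-m)} ≲ max{w/√n, w²}e^{-αw²n}`"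
of the printed proof, for `w ∈ [c/n, w₀[` (the constants depend on `c` through Prop. 5.1's `κ`,
and on the law `τ`). [cite: AjankiHuveneers2011, §6.2 eqs. (6.11), (6.13)-(6.15) and the display before (6.16) (arXiv v1 numbering)] -/
def AjankiHuveneers2011_pointwiseCurrentBound : Prop :=
  ∀ (τ : ℝ → ℝ) (bm bp : ℝ), ReducedLawHyp τ bm bp →
    ∀ (ρB : Measure ℝ) [IsProbabilityMeasure ρB],
      ρB = volume.withDensity (fun s => ENNReal.ofReal (τ s)) →
      ∀ c : ℝ, 0 < c → ∃ w₀ : ℝ, 0 < w₀ ∧ ∃ α : ℝ, 0 < α ∧ ∃ C : ℝ, ∀ n : ℕ, 1 ≤ n →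
        ∀ w ∈ Set.Icc (c / n) w₀,
          ∫ B, w ^ 2 / (w ^ 2 + (ahD (ahDiag w (finExt B)) 1 0 n) ^ 2)
              ∂(Measure.pi fun _ : Fin n => ρB) ≤
            C * max (w / Real.sqrt n) (w ^ 2) * Real.exp (-(α * w ^ 2 * n))

/-- **Reduction of (U) to the pointwise bound** (AH2011 §6.2 assembled): split
`∫_0^{ω₀} 𝔼 j_n = ∫_0^{c₁/n} + ∫_{c₁/n}^{ω₀}`; the first piece is `≤ 4c₁³/n⁵` by the linear growth
of `D_n(e₁)` (`𝒥₁`, (6.12)); on the second, pass to reduced variables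
(`𝔼 j_n(ω) ≤ max(π²/μ,1) 𝔼_B[w²/(w² + D_n(e₁;w,B)²)]`, `w = ω√μ/π`, `μ = 𝔼M`, law of `B` =
`τ_B(t)dt` satisfying `ReducedLawHyp`), apply the pointwise bound with `c = c₁√μ/π`, and integrate
`max{ω/√n, ω²}e^{-α'ω²n} ≤ (ω/√n + ω²)e^{-α'ω²n}` over `(0, ω₀]`: `≤ (1/(2α') + α'^{-3/2}) n^{-3/2}`
(`𝒥₂`, (6.16)). [cite: AjankiHuveneers2011, §6.2 eqs. (6.10), (6.12), (6.16)] -/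
theorem AjankiHuveneers2011_lowFrequencyBound_of_pointwise
    (hP : AjankiHuveneers2011_pointwiseCurrentBound) : AjankiHuveneers2011_lowFrequencyBound := by
  intro τ a b hyp ρ _ hρ
  -- reduced data
  have hμ : 0 < meanMass τ := hyp.meanMass_pos
  have hb : 0 < b := hyp.pos.trans hyp.lt
  set e := reducedEquiv (meanMass τ) hyp.meanMass_pos.ne' with he
  set ρB : Measure ℝ := ρ.map e with hρBdef
  haveI : IsProbabilityMeasure ρB := isProbabilityMeasure_map_reducedEquiv hyp ρ
  have hρB : ρB = volume.withDensity (fun s => ENNReal.ofReal (reducedDensity τ s)) := by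
    rw [hρBdef, hρ, he]
    exact map_reducedEquiv_withDensity hyp
  have hred := hyp.reducedLawHyp
  -- constants
  set c₁ : ℝ := 1 / (2 * (b + 1)) with hc₁
  have hc₁0 : 0 < c₁ := by positivity
  set κ : ℝ := Real.sqrt (meanMass τ) / π with hκ
  have hκ0 : 0 < κ := by positivity
  obtain ⟨w₀, hw₀, α, hα, C, hC⟩ := hP _ _ _ hred ρB hρB (c₁ * κ) (by positivity)
  set Λ : ℝ := max (π ^ 2 / meanMass τ) 1 with hΛ
  have hΛ0 : 0 < Λ := lt_of_lt_of_le one_pos (le_max_right _ _)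
  set α' : ℝ := α * κ ^ 2 with hα'
  have hα'0 : 0 < α' := by positivity
  set A : ℝ := Λ * (|C| * max κ (κ ^ 2)) with hA
  have hA0 : 0 ≤ A := by positivity
  set K : ℝ := 4 * c₁ ^ 3 + A * (1 / (2 * α') + 1 / (α' * Real.sqrt α')) with hK
  refine ⟨w₀ / κ, by positivity, K, fun n hn => ?_⟩
  obtain ⟨k, rfl⟩ : ∃ k, n = k + 1 := ⟨n - 1, by omega⟩
  have hnpos : (0 : ℝ) < ((k + 1 : ℕ) : ℝ) := by positivity
  have hn1 : (1 : ℝ) ≤ ((k + 1 : ℕ) : ℝ) := by exact_mod_cast hn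
  set s : ℝ := Real.sqrt ((k + 1 : ℕ) : ℝ) with hsdef
  have hs : 0 < s := Real.sqrt_pos.mpr hnpos
  have hs1 : 1 ≤ s := by rw [hsdef]; exact Real.one_le_sqrt.mpr hn1
  have h32 : ((k + 1 : ℕ) : ℝ) ^ (3 / 2 : ℝ) = ((k + 1 : ℕ) : ℝ) * s := by
    rw [hsdef, show (3 / 2 : ℝ) = 1 + 1 / 2 by norm_num, Real.rpow_add hnpos, Real.rpow_one,
      Real.sqrt_eq_rpow]
  have hae := ae_pi_mem_Icc hyp.eq_zero hρ (k + 1)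
  -- the split point
  set T : ℝ := w₀ / κ with hT
  have hT0 : 0 < T := by positivity
  set t : ℝ := min (c₁ / ((k + 1 : ℕ) : ℝ)) T with ht
  have ht0 : 0 ≤ t := le_min (by positivity) hT0.le
  have htT : t ≤ T := min_le_right _ _
  have htc : t ≤ c₁ / ((k + 1 : ℕ) : ℝ) := min_le_left _ _
  have hfin : ∀ u v : ℝ, volume (Set.Ioc u v) ≠ ⊤ := fun u v => by
    rw [Real.volume_Ioc]; exact ENNReal.ofReal_ne_top
  have hI1 := integrableOn_clAvgCurrentDensity ρ (k + 1) (hfin 0 t)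
  have hI2 := integrableOn_clAvgCurrentDensity ρ (k + 1) (hfin t T)
  have hsplit : ∫ ω in Set.Ioc 0 T, clAvgCurrentDensity ρ (k + 1) ω =
      (∫ ω in Set.Ioc 0 t, clAvgCurrentDensity ρ (k + 1) ω) +
        ∫ ω in Set.Ioc t T, clAvgCurrentDensity ρ (k + 1) ω := by
    rw [← setIntegral_union (Set.Ioc_disjoint_Ioc_of_le le_rfl) measurableSet_Ioc hI1 hI2,
      Set.Ioc_union_Ioc_eq_Ioc ht0 htT]
  -- piece 1: `𝒥₁`
  have hP1 : ∫ ω in Set.Ioc 0 t, clAvgCurrentDensity ρ (k + 1) ω ≤ 4 * c₁ ^ 3 / (((k + 1 : ℕ) : ℝ) * s) := by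
    have hbound : ∀ ω ∈ Set.Ioc 0 t, clAvgCurrentDensity ρ (k + 1) ω ≤ 4 * c₁ ^ 2 / ((k + 1 : ℕ) : ℝ) ^ 4 :=
      fun ω hω => clAvgCurrentDensity_le_lowest hyp.pos ρ hae hω.1.le (hω.2.trans htc)
    calc ∫ ω in Set.Ioc 0 t, clAvgCurrentDensity ρ (k + 1) ω
        ≤ ∫ _ω in Set.Ioc 0 t, 4 * c₁ ^ 2 / ((k + 1 : ℕ) : ℝ) ^ 4 :=
          setIntegral_mono_on hI1 (integrableOn_const (hfin 0 t)) measurableSet_Ioc hbound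
      _ = t * (4 * c₁ ^ 2 / ((k + 1 : ℕ) : ℝ) ^ 4) := by
          rw [setIntegral_const, Real.volume_real_Ioc_of_le ht0, sub_zero, smul_eq_mul]
      _ ≤ c₁ / ((k + 1 : ℕ) : ℝ) * (4 * c₁ ^ 2 / ((k + 1 : ℕ) : ℝ) ^ 4) :=
          mul_le_mul_of_nonneg_right htc (by positivity)
      _ = 4 * c₁ ^ 3 / ((k + 1 : ℕ) : ℝ) ^ 5 := by
          field_simp
      _ ≤ 4 * c₁ ^ 3 / (((k + 1 : ℕ) : ℝ) * s) := by
          refine div_le_div_of_nonneg_left (by positivity) (by positivity) ?_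
          have hs_le : s ≤ ((k + 1 : ℕ) : ℝ) := by
            rw [hsdef, Real.sqrt_le_left hnpos.le]
            nlinarith
          calc ((k + 1 : ℕ) : ℝ) * s ≤ ((k + 1 : ℕ) : ℝ) * ((k + 1 : ℕ) : ℝ) :=
                mul_le_mul_of_nonneg_left hs_le hnpos.le
            _ = ((k + 1 : ℕ) : ℝ) ^ 2 := by ring
            _ ≤ ((k + 1 : ℕ) : ℝ) ^ 5 := pow_le_pow_right₀ hn1 (by norm_num)
  -- piece 2: `𝒥₂`
  set G : ℝ → ℝ := fun ω => A * ((ω / s + ω ^ 2) * Real.exp (-(α' * ((k + 1 : ℕ) : ℝ) * ω ^ 2))) with hG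
  have hGc : Continuous G := by
    rw [hG]
    fun_prop
  have hG0 : ∀ ω, 0 ≤ ω → 0 ≤ G ω := fun ω hω => by rw [hG]; positivity
  have hP2 : ∫ ω in Set.Ioc t T, clAvgCurrentDensity ρ (k + 1) ω ≤ ∫ ω in Set.Ioc 0 T, G ω := by
    have hGi : IntegrableOn G (Set.Ioc 0 T) := hGc.integrableOn_Icc.mono_set Set.Ioc_subset_Icc_self
    have hbound : ∀ ω ∈ Set.Ioc t T, clAvgCurrentDensity ρ (k + 1) ω ≤ G ω := by
      intro ω hω
      -- here `t = c₁/n`, since `t < ω ≤ T`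
      have htc' : t = c₁ / ((k + 1 : ℕ) : ℝ) := by
        rcases min_choice (c₁ / ((k + 1 : ℕ) : ℝ)) T with h | h
        · exact h
        · exfalso
          rw [ht, h] at hω
          exact lt_irrefl _ (hω.1.trans_le hω.2)
      have hω0 : 0 < ω := lt_of_le_of_lt ht0 hω.1
      set w : ℝ := ω * Real.sqrt (meanMass τ) / π with hw
      have hwκ : w = κ * ω := by rw [hw, hκ]; ring
      have hωw : π * w / Real.sqrt (meanMass τ) = ω := by
        have hsμ : 0 < Real.sqrt (meanMass τ) := Real.sqrt_pos.mpr hμ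
        rw [hw]
        field_simp
      have hw_mem : w ∈ Set.Icc (c₁ * κ / ((k + 1 : ℕ) : ℝ)) w₀ := by
        constructor
        · rw [hwκ, mul_comm c₁ κ, mul_div_assoc]
          exact mul_le_mul_of_nonneg_left (by rw [← htc']; exact hω.1.le) hκ0.le
        · rw [hwκ]
          calc κ * ω ≤ κ * T := mul_le_mul_of_nonneg_left hω.2 hκ0.le
            _ = w₀ := by rw [hT]; field_simp
      have hCn := hC (k + 1) hn w hw_mem
      have hcmp := clAvgCurrentDensity_le_majorant hyp ρ k w
      rw [hωw] at hcmp
      have hmax : max (w / Real.sqrt ((k + 1 : ℕ) : ℝ)) (w ^ 2) ≤ max κ (κ ^ 2) * (ω / s + ω ^ 2) := by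
        rw [← hsdef, hwκ]
        refine max_le ?_ ?_
        · calc κ * ω / s = κ * (ω / s) := by ring
            _ ≤ max κ (κ ^ 2) * (ω / s) := mul_le_mul_of_nonneg_right (le_max_left _ _) (by positivity)
            _ ≤ max κ (κ ^ 2) * (ω / s + ω ^ 2) :=
                mul_le_mul_of_nonneg_left (le_add_of_nonneg_right (sq_nonneg ω)) (by positivity)
        · calc (κ * ω) ^ 2 = κ ^ 2 * ω ^ 2 := by ring
            _ ≤ max κ (κ ^ 2) * ω ^ 2 := mul_le_mul_of_nonneg_right (le_max_right _ _) (sq_nonneg ω)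
            _ ≤ max κ (κ ^ 2) * (ω / s + ω ^ 2) :=
                mul_le_mul_of_nonneg_left (le_add_of_nonneg_left (by positivity)) (by positivity)
      have hexp : Real.exp (-(α * w ^ 2 * ((k + 1 : ℕ) : ℝ))) =
          Real.exp (-(α' * ((k + 1 : ℕ) : ℝ) * ω ^ 2)) := by
        rw [hwκ, hα']; ring_nf
      calc clAvgCurrentDensity ρ (k + 1) ω
          ≤ Λ * ∫ B, w ^ 2 / (w ^ 2 + (ahD (ahDiag w (finExt B)) 1 0 (k + 1)) ^ 2)
              ∂(Measure.pi fun _ : Fin (k + 1) => ρB) := hcmp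
        _ ≤ Λ * (C * max (w / Real.sqrt ((k + 1 : ℕ) : ℝ)) (w ^ 2) * Real.exp (-(α * w ^ 2 * ((k + 1 : ℕ) : ℝ)))) :=
            mul_le_mul_of_nonneg_left hCn hΛ0.le
        _ ≤ Λ * (|C| * (max κ (κ ^ 2) * (ω / s + ω ^ 2)) * Real.exp (-(α' * ((k + 1 : ℕ) : ℝ) * ω ^ 2))) := by
            rw [hexp]
            refine mul_le_mul_of_nonneg_left (mul_le_mul_of_nonneg_right ?_ (Real.exp_pos _).le) hΛ0.le
            calc C * max (w / Real.sqrt ((k + 1 : ℕ) : ℝ)) (w ^ 2)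
                ≤ |C| * max (w / Real.sqrt ((k + 1 : ℕ) : ℝ)) (w ^ 2) :=
                  mul_le_mul_of_nonneg_right (le_abs_self C)
                    (le_trans (by rw [hwκ]; positivity) (le_max_right _ _))
              _ ≤ |C| * (max κ (κ ^ 2) * (ω / s + ω ^ 2)) := mul_le_mul_of_nonneg_left hmax (abs_nonneg C)
        _ = G ω := by rw [hG, hA]; ring
    calc ∫ ω in Set.Ioc t T, clAvgCurrentDensity ρ (k + 1) ω
        ≤ ∫ ω in Set.Ioc t T, G ω :=
          setIntegral_mono_on hI2 (hGi.mono_set (Set.Ioc_subset_Ioc_left ht0)) measurableSet_Ioc hbound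
      _ ≤ ∫ ω in Set.Ioc 0 T, G ω :=
          setIntegral_mono_set hGi ((ae_restrict_mem measurableSet_Ioc).mono fun ω hω => hG0 ω hω.1.le)
            (Set.Ioc_subset_Ioc_left ht0).eventuallyLE
  have hP2' : ∫ ω in Set.Ioc 0 T, G ω ≤ A * (1 / (2 * α') + 1 / (α' * Real.sqrt α')) / (((k + 1 : ℕ) : ℝ) * s) := by
    set β : ℝ := α' * ((k + 1 : ℕ) : ℝ) with hβ
    have hβ0 : 0 < β := by positivity
    have hc1 : Continuous fun ω : ℝ => ω * Real.exp (-(β * ω ^ 2)) := by fun_prop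
    have hc2 : Continuous fun ω : ℝ => ω ^ 2 * Real.exp (-(β * ω ^ 2)) := by fun_prop
    have hi1 : IntegrableOn (fun ω : ℝ => ω * Real.exp (-(β * ω ^ 2))) (Set.Ioc 0 T) :=
      hc1.integrableOn_Icc.mono_set Set.Ioc_subset_Icc_self
    have hi2 : IntegrableOn (fun ω : ℝ => ω ^ 2 * Real.exp (-(β * ω ^ 2))) (Set.Ioc 0 T) :=
      hc2.integrableOn_Icc.mono_set Set.Ioc_subset_Icc_self
    have hGeq : ∀ ω, G ω = A / s * (ω * Real.exp (-(β * ω ^ 2))) + A * (ω ^ 2 * Real.exp (-(β * ω ^ 2))) := by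
      intro ω
      simp only [hG, hβ]
      field_simp
    have hsβ : Real.sqrt β = Real.sqrt α' * s := by
      rw [hβ, hsdef, Real.sqrt_mul hα'0.le]
    calc ∫ ω in Set.Ioc 0 T, G ω
        = A / s * (∫ ω in Set.Ioc 0 T, ω * Real.exp (-(β * ω ^ 2))) +
            A * ∫ ω in Set.Ioc 0 T, ω ^ 2 * Real.exp (-(β * ω ^ 2)) := by
          simp_rw [hGeq]
          rw [integral_add (hi1.const_mul _) (hi2.const_mul _), integral_const_mul, integral_const_mul]
      _ ≤ A / s * (1 / (2 * β)) + A * (1 / (β * Real.sqrt β)) :=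
          add_le_add (mul_le_mul_of_nonneg_left (integral_mul_exp_neg_sq_le hβ0 hT0.le) (div_nonneg hA0 hs.le))
            (mul_le_mul_of_nonneg_left (integral_sq_mul_exp_neg_sq_le hβ0 hT0.le) hA0)
      _ = A * (1 / (2 * α') + 1 / (α' * Real.sqrt α')) / (((k + 1 : ℕ) : ℝ) * s) := by
          rw [hsβ, hβ]
          have hsα : 0 < Real.sqrt α' := Real.sqrt_pos.mpr hα'0
          field_simp
  -- assemble
  rw [hsplit, h32]
  calc (∫ ω in Set.Ioc 0 t, clAvgCurrentDensity ρ (k + 1) ω) + ∫ ω in Set.Ioc t T, clAvgCurrentDensity ρ (k + 1) ω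
      ≤ 4 * c₁ ^ 3 / (((k + 1 : ℕ) : ℝ) * s) +
          A * (1 / (2 * α') + 1 / (α' * Real.sqrt α')) / (((k + 1 : ℕ) : ℝ) * s) :=
        add_le_add hP1 (hP2.trans hP2')
    _ = K / (((k + 1 : ℕ) : ℝ) * s) := by rw [hK]; ring

end Literature.Barriers.AtomisticToContinuum

end
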